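import Mathlib
import HarnessLib
import Literature.Analysis.FluidPDE.SuitableWeak
import Literature.Analysis.FluidPDE.SelfSimilar
import Literature.Analysis.FluidPDE.LocalTypeI
import Literature.Analysis.FluidPDE.ESSLocalHolderNoConcentration
import Summits.NavierStokesRegularity.NavierStokesRegularity.Theorems.RellichScarNoMildScar

/-!
# The far-field vorticity vanishes in a cone (line calm-cone-carleman, crux ApexLocalisation stmt-NavierStokesRegularity-11719, stub `stub_coneFarFieldCurl`)

Step S2c (cone widening) of the line `calm-cone-carleman`: the landed half-space statement
`stub_halfspaceFarFieldCurl` (Escauriaza–Seregin–Šverák 2003, §3, (3.31)–(3.32): "`ω = 0`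
beyond the ball by backward uniqueness") with the translated open half-space
`x₀ + {y | 0 < ⟪y, e⟫}` replaced by the translated open cone `x₀ + Γ`, `Γ = {y | κ‖y‖ < ⟪y, e⟫}`
(`‖e‖ = 1`, `κ ∈ ℝ` arbitrary), and with the half-space backward uniqueness theorem (ESS
Thm. 5.1) replaced by the HYPOTHESIS that `Γ` has the backward uniqueness property in the class
`C¹ ∩ {∂ₓv ∈ C¹}` for fields bounded by `1` on `]0, 1[ × Γ` (for cones of opening angle larger
than some `θ₀ < π/2`, i.e. some `κ < 0`, this is Li–Šverák 2012, Thm. 1.1).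
Setting: `S ⊆ ℝ³` is open and contains `x₀ + Γ`; `U` is the smooth-in-space representative of a
field `w` on `]-1, 0[ × S` — a distributional solution `(U, π)` of the Navier–Stokes system there
with `C⁴` slices, jointly continuous spatial derivatives `D_xⁿU`, `n ≤ 4`, and `‖D_xⁿU‖ ≤ K`,
`n ≤ 3` — and the slices of `w` tend weakly to zero at the top time.  Conclusion:
`curl U(t, ·) = 0` at every point of `]-1, 0[ × (x₀ + Γ)`.

Proof (verbatim the half-space one with `H := Γ`): the vorticity `ω = curl U` is of the class
`C¹ ∩ {∂ₓω ∈ C¹}` (`vorticity_c12_of_isDistributionalNSSolutionOn`), satisfies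
`|∂ₜω - Δω| ≤ 2K(|ω| + |∇ω|)` (`vorticity_carleman_inequality`), is bounded together with `∂ₜω`
(`vorticity_pointwise_bounds`), and tends to zero at the top uniformly near every point of `S`
(`exists_uniform_small_near_top`); the time-reversed, normalised, translated field
`u(s, y) = c₀ ω(-s, x₀ + y)` extended by `0` at `s = 0` satisfies every hypothesis of the assumed
backward uniqueness property of `]0, 1[ × Γ`, hence vanishes there, i.e. `ω = 0` on
`]-1, 0[ × (x₀ + Γ)`.  (Nonnegativity of `K` is read off at the target point itself, so no
nonemptiness of `Γ` is needed.)

* `stub_coneFarFieldCurl` — the statement S2c.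

References: L. Escauriaza, G. Seregin, V. Šverák, *`L_{3,∞}`-solutions of Navier–Stokes
equations and backward uniqueness*, Russ. Math. Surveys 58 (2003) 211–250, §3 (3.31)–(3.32)
[EscauriazaSereginSverak2003]; L. Li, V. Šverák, *Backward uniqueness for the heat equation in
cones*, Comm. PDE 37 (2012) 1414–1429, Thm. 1.1 (arXiv:1011.2796) [LiSverak2012].
-/

noncomputable section

set_option linter.dupNamespace false

namespace Summit.NavierStokesRegularity.NavierStokesRegularity.Theorems.RellichScarApexLocalisation

open MeasureTheory Set Function Metric Filter Topology TopologicalSpace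
open scoped ENNReal NNReal InnerProductSpace RealInnerProductSpace
open Literature.Analysis Literature.Analysis.FluidPDE

local notation "E³" => EuclideanSpace ℝ (Fin 3)

/-- The open backward slab `(-∞, 0) × ℝ³` (time first). -/
local notation "𝕊" => Literature.Analysis.FluidPDE.slab (EuclideanSpace ℝ (Fin 3)) (Set.Iio (0 : ℝ)) isOpen_Iio

set_option maxHeartbeats 1600000 in
/-- **The far-field vorticity vanishes in a cone** (Escauriaza–Seregin–Šverák 2003, §3,
(3.31)–(3.32): "`ω = 0` on `(ℝ³ ∖ B̄(R)) × ]-T₂, 0[`" by backward uniqueness), in the geometry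
of a translated open cone `x₀ + Γ`, `Γ = {y | κ‖y‖ < ⟪y, e⟫}` (`‖e‖ = 1`), inside an arbitrary
open far region `S ⊇ x₀ + Γ`, CONDITIONAL on the backward uniqueness property of `]0, 1[ × Γ` in
the class `C¹ ∩ {∂ₓv ∈ C¹}` for fields bounded by `1` (the third hypothesis; for wide enough
cones this is Li–Šverák 2012, Thm. 1.1, for half-spaces ESS Thm. 5.1).  Setting: `U` is the
smooth-in-space representative of `w` on `Ω = ]-1, 0[ × S` — a distributional solution `(U, π)`
of the Navier–Stokes system there with `C⁴` slices, jointly continuous spatial derivatives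
`D_xⁿU`, `n ≤ 4`, and `‖D_xⁿU‖ ≤ K`, `n ≤ 3` — and the slices of `w` tend weakly to zero at the
top time.  Then `curl U(t, ·) = 0` at every point of `]-1, 0[ × {x | κ‖x - x₀‖ < ⟪x - x₀, e⟫}`.
Proof: the vorticity `ω = curl U` is of the class `C¹ ∩ {∂ₓω ∈ C¹}` and satisfies
`|∂ₜω - Δω| ≤ 2K(|ω| + |∇ω|)` (`vorticity_carleman_inequality`), is bounded, and tends to zero
at the top uniformly near every point of `S` (`exists_uniform_small_near_top`); the
time-reversed, normalised, translated field `u(s, y) = c₀ ω(-s, x₀ + y)` extended by `0` at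
`s = 0` satisfies every hypothesis of the assumed backward uniqueness property, hence vanishes
on `]0, 1[ × Γ`.  This is `stub_halfspaceFarFieldCurl` with the half-space replaced by `Γ`.
[cite: EscauriazaSereginSverak2003, §3 (3.31)-(3.32)] [cite: LiSverak2012, Thm. 1.1] -/
theorem stub_coneFarFieldCurl :
    ∀ (κ : ℝ) (S : Set E³) (hS : IsOpen S) (x₀ e : E³), ‖e‖ = 1 →
      (∀ y : E³, κ * ‖y‖ < ⟪y, e⟫ → x₀ + y ∈ S) →
      (∀ (v : ℝ × E³ → E³) (c₁ : ℝ), 0 ≤ c₁ →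
        ContDiffOn ℝ 1 v (Ioo (0 : ℝ) 1 ×ˢ {y : E³ | κ * ‖y‖ < ⟪y, e⟫}) →
        (∀ e' : E³, ContDiffOn ℝ 1 (Carleman.dx e' v) (Ioo (0 : ℝ) 1 ×ˢ {y : E³ | κ * ‖y‖ < ⟪y, e⟫})) →
        ContinuousOn v (Ico (0 : ℝ) 1 ×ˢ {y : E³ | κ * ‖y‖ < ⟪y, e⟫}) →
        (∀ y : E³, κ * ‖y‖ < ⟪y, e⟫ → v (0, y) = 0) →
        (∀ z ∈ Ioo (0 : ℝ) 1 ×ˢ {y : E³ | κ * ‖y‖ < ⟪y, e⟫},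
          ‖Carleman.dt v z + Carleman.lap v z‖ ≤ c₁ * (‖v z‖ + Real.sqrt (Carleman.gradSq v z))) →
        (∀ z ∈ Ioo (0 : ℝ) 1 ×ˢ {y : E³ | κ * ‖y‖ < ⟪y, e⟫}, ‖v z‖ ≤ 1) →
        (∀ K' ⊆ Ioo (0 : ℝ) 1 ×ˢ {y : E³ | κ * ‖y‖ < ⟪y, e⟫}, Bornology.IsBounded K' → MeasurableSet K' →
          ∫⁻ z in K', ‖Carleman.dt v z‖ₑ ^ 2 < ∞) →
        ∀ z ∈ Ioo (0 : ℝ) 1 ×ˢ {y : E³ | κ * ‖y‖ < ⟪y, e⟫}, v z = 0) →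
      ∀ (w U : ℝ → E³ → E³) (π : ℝ → E³ → ℝ) (K : ℝ),
      (∀ φ : E³ → E³, ContDiff ℝ (⊤ : ℕ∞) φ → HasCompactSupport φ → ∀ ε : ℝ, 0 < ε →
        ∃ s₀ : ℝ, s₀ < 0 ∧ ∀ᵐ s ∂(volume.restrict (Ioo s₀ 0)), |∫ y, ⟪w s y, φ y⟫| ≤ ε) →
      uncurry U =ᵐ[volume.restrict (Ioo (-1 : ℝ) 0 ×ˢ S)] uncurry w →
      IsDistributionalNSSolutionOn ⟨Ioo (-1 : ℝ) 0 ×ˢ S, isOpen_Ioo.prod hS⟩ 1 0 U π →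
      (∀ t ∈ Ioo (-1 : ℝ) 0, ContDiffOn ℝ 4 (U t) S) →
      (∀ n ≤ 4, ContinuousOn (fun z : ℝ × E³ => iteratedFDeriv ℝ n (U z.1) z.2) (Ioo (-1 : ℝ) 0 ×ˢ S)) →
      (∀ n ≤ 3, ∀ z ∈ Ioo (-1 : ℝ) 0 ×ˢ S, ‖iteratedFDeriv ℝ n (U z.1) z.2‖ ≤ K) →
      ∀ z ∈ Ioo (-1 : ℝ) 0 ×ˢ {x : E³ | κ * ‖x - x₀‖ < ⟪x - x₀, e⟫}, curl (U z.1) z.2 = 0 := by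
  intro κ S hS x₀ e he hx₀S hBU w U π K htop hae hsol hU4 hΦ hK
  -- fix the target point first: it witnesses that the cone is nonempty, whence `0 ≤ K`
  rintro ⟨t, x⟩ ⟨ht, hx⟩
  -- ### notation and basic facts
  set I : Set ℝ := Ioo (-1 : ℝ) 0 with hI
  have hIo : IsOpen I := isOpen_Ioo
  set O : Set (ℝ × E³) := I ×ˢ S with hOdef
  have hOo : IsOpen O := hIo.prod hS
  have hxS : x ∈ S := by
    have h := hx₀S (x - x₀) hx
    rwa [add_sub_cancel] at h
  have hK0 : 0 ≤ K := by
    have hz : ((-(1 : ℝ) / 2, x) : ℝ × E³) ∈ O := ⟨⟨by norm_num, by norm_num⟩, hxS⟩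
    exact (norm_nonneg _).trans (hK 0 (by norm_num) _ hz)
  -- bounds on `U` and `D U` in the usual form
  have hK₀ : ∀ z ∈ O, ‖U z.1 z.2‖ ≤ K := fun z hz => by
    have h := hK 0 (by norm_num) z hz
    rwa [norm_iteratedFDeriv_zero] at h
  have hK₁ : ∀ z ∈ O, ‖fderiv ℝ (U z.1) z.2‖ ≤ K := fun z hz => by
    have h := hK 1 (by norm_num) z hz
    rwa [norm_iteratedFDeriv_one] at h
  -- ### the vorticity: class, equation, bounds
  obtain ⟨-, hU0, -, hω1, hωx⟩ :=
    vorticity_c12_of_isDistributionalNSSolutionOn hIo hS hsol hU4 hΦ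
  obtain ⟨hdt, -, hineq⟩ := vorticity_carleman_inequality hIo hS hsol hU4 hΦ hK₀ hK₁
  have hκ0 : 0 ≤ ‖curlCLM‖ := ContinuousLinearMap.opNorm_nonneg _
  -- pointwise bounds: `|ω| ≤ ‖curlCLM‖K`, `|∂ₜω| ≤ (3 * 1 * ‖curlCLM‖ * K + 2 * ‖curlCLM‖ * K ^ 2)`
  have hbounds : ∀ z ∈ O, ‖(uncurry (vorticity U)) z‖ ≤ ‖curlCLM‖ * K ∧
      ‖Carleman.dt (uncurry (vorticity U)) z‖ ≤ (3 * 1 * ‖curlCLM‖ * K + 2 * ‖curlCLM‖ * K ^ 2) := by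
    intro z hz
    have hU3 : ContDiffOn ℝ 3 (U z.1) S := (hU4 z.1 hz.1).of_le (by norm_cast)
    obtain ⟨b0, -, -, b3⟩ := vorticity_pointwise_bounds hS hU3 hz.2 hK0 zero_le_one
      (hK₀ z hz) (hK₁ z hz) (hK 2 (by norm_num) z hz) (hK 3 le_rfl z hz)
    refine ⟨?_, ?_⟩
    · show ‖vorticity U z.1 z.2‖ ≤ _
      simpa [vorticity_apply] using b0
    · rw [hdt z hz]
      simpa [vorticity_apply] using b3
  -- ### uniform smallness at the top
  have hU2 : ∀ z ∈ O, ContDiffAt ℝ 2 (U z.1) z.2 := fun z hz =>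
    ((hU4 z.1 hz.1).of_le (by norm_cast)).contDiffAt (hS.mem_nhds hz.2)
  have hK₂ : ∀ z ∈ O, ‖iteratedFDeriv ℝ 2 (U z.1) z.2‖ ≤ K := fun z hz => hK 2 (by norm_num) z hz
  have hsmall := fun (x₁ : E³) (hx₁ : x₁ ∈ S) (θ : ℝ) (hθ : 0 < θ) =>
    exists_uniform_small_near_top (w := w) (U := U) (a := -1) (by norm_num) hS htop hae hU0 hU2
      hK₁ hK₂ hx₁ hθ
  -- ### the cone `H = {κ‖y‖ < ⟪y, e⟫}` and the cylinder `Q = ]0, 1[ × H`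
  set H : Set E³ := {y : E³ | κ * ‖y‖ < ⟪y, e⟫} with hHdef
  have hHo : IsOpen H :=
    isOpen_lt (continuous_const.mul continuous_norm) (continuous_id.inner continuous_const)
  set Q : Set (ℝ × E³) := Ioo (0 : ℝ) 1 ×ˢ H with hQdef
  have hQo : IsOpen Q := isOpen_Ioo.prod hHo
  -- the affine change of variables `A(s, y) = (-s, x₀ + y)`
  set A : ℝ × E³ → ℝ × E³ := stAffine (-1) 1 0 x₀ with hAdef
  have hA : ∀ z : ℝ × E³, A z = (-z.1, x₀ + z.2) := fun z => by
    simp [hAdef, stAffine]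
  have hAO : ∀ z ∈ Q, A z ∈ O := by
    rintro ⟨s', y⟩ ⟨hs', hy⟩
    rw [hA]
    exact ⟨⟨by linarith [hs'.2], by linarith [hs'.1]⟩, hx₀S y hy⟩
  have hpre : Q ⊆ A ⁻¹' O := fun z hz => hAO z hz
  -- the normalised, time-reversed vorticity
  set c₀ : ℝ := (‖curlCLM‖ * K + 1)⁻¹ with hc₀def
  have hc₀ : 0 < c₀ := by positivity
  have hc₀1 : c₀ * (‖curlCLM‖ * K) ≤ 1 := by
    rw [hc₀def, inv_mul_le_iff₀ (by positivity)]
    linarith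
  set ut : ℝ × E³ → E³ := fun z => c₀ • (uncurry (vorticity U)) (A z) with hutdef
  set u : ℝ × E³ → E³ := fun z => if 0 < z.1 then ut z else 0 with hudef
  have huQ : ∀ z ∈ Q, u z = ut z := fun z hz => if_pos hz.1.1
  -- ### regularity of `ut` and `u` on `Q`
  have hut1 : ContDiffOn ℝ 1 ut Q :=
    ((Carleman.contDiffOn_comp_stAffine hω1 (-1) 1 0 x₀).const_smul c₀).mono hpre
  have hdxut : ∀ e' : E³, Carleman.dx e' ut =
      fun z => c₀ • Carleman.dx e' (uncurry (vorticity U)) (A z) := by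
    intro e'
    rw [hutdef, Carleman.dx_const_smul_eq]
    funext z
    rw [Carleman.dx_comp_stAffine (by norm_num) one_ne_zero (uncurry (vorticity U)) e' z, one_smul]
  have hutx : ∀ e' : E³, ContDiffOn ℝ 1 (Carleman.dx e' ut) Q := by
    intro e'
    rw [hdxut e']
    exact ((Carleman.contDiffOn_comp_stAffine (hωx e') (-1) 1 0 x₀).const_smul c₀).mono hpre
  have hframe : ∀ z ∈ Q, Carleman.dt u z = Carleman.dt ut z ∧
      (∀ e', Carleman.dx e' u z = Carleman.dx e' ut z) ∧
      (∀ e', Carleman.dx e' (Carleman.dx e' u) z = Carleman.dx e' (Carleman.dx e' ut) z) ∧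
      Carleman.lap u z = Carleman.lap ut z ∧ Carleman.gradSq u z = Carleman.gradSq ut z :=
    fun z hz => Carleman.frame_eq_of_eventuallyEq hQo hz huQ
  have hu1 : ContDiffOn ℝ 1 u Q := hut1.congr huQ
  have hux : ∀ e' : E³, ContDiffOn ℝ 1 (Carleman.dx e' u) Q := fun e' =>
    (hutx e').congr fun z hz => (hframe z hz).2.1 e'
  -- frame operators of `ut` in terms of those of `(uncurry (vorticity U))`
  have hdtut : ∀ z, Carleman.dt ut z =
      c₀ • ((-1 : ℝ) • Carleman.dt (uncurry (vorticity U)) (A z)) := fun z => by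
    rw [hutdef, Carleman.dt_const_smul_apply, Carleman.dt_comp_stAffine (by norm_num) one_ne_zero]
  have hlaput : ∀ z, Carleman.lap ut z = c₀ • Carleman.lap (uncurry (vorticity U)) (A z) := fun z => by
    rw [hutdef, Carleman.lap_const_smul_apply, Carleman.lap_comp_stAffine (by norm_num) one_ne_zero,
      one_pow, one_smul]
  have hgradut : ∀ z, Carleman.gradSq ut z =
      c₀ ^ 2 * Carleman.gradSq (uncurry (vorticity U)) (A z) := fun z => by
    rw [hutdef, Carleman.gradSq_const_smul_apply,
      Carleman.gradSq_comp_stAffine (by norm_num) one_ne_zero, one_pow, one_mul]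
  have hnormut : ∀ z, ‖ut z‖ = c₀ * ‖(uncurry (vorticity U)) (A z)‖ := fun z => by
    rw [hutdef, norm_smul, Real.norm_eq_abs, abs_of_pos hc₀]
  have hsqrtut : ∀ z, Real.sqrt (Carleman.gradSq ut z) =
      c₀ * Real.sqrt (Carleman.gradSq (uncurry (vorticity U)) (A z)) :=
    fun z => by rw [hgradut, Real.sqrt_mul (sq_nonneg _), Real.sqrt_sq hc₀.le]
  -- ### (hBH) the differential inequality
  have hBH : ∀ z ∈ Q, ‖Carleman.dt u z + Carleman.lap u z‖ ≤
      (2 * K) * (‖u z‖ + Real.sqrt (Carleman.gradSq u z)) := by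
    intro z hz
    obtain ⟨h1, -, -, h4, h5⟩ := hframe z hz
    rw [h1, h4, h5, huQ z hz, hdtut, hlaput, hnormut, hsqrtut]
    have e1 : c₀ • ((-1 : ℝ) • Carleman.dt (uncurry (vorticity U)) (A z)) +
        c₀ • Carleman.lap (uncurry (vorticity U)) (A z) =
        -(c₀ • (Carleman.dt (uncurry (vorticity U)) (A z) -
          Carleman.lap (uncurry (vorticity U)) (A z))) := by
      simp only [smul_sub, neg_one_smul, smul_neg]
      abel
    rw [e1, norm_neg, norm_smul, Real.norm_eq_abs, abs_of_pos hc₀]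
    have h := hineq (A z) (hAO z hz)
    calc c₀ * ‖Carleman.dt (uncurry (vorticity U)) (A z) - Carleman.lap (uncurry (vorticity U)) (A z)‖
        ≤ c₀ * ((K + K) * (‖(uncurry (vorticity U)) (A z)‖ +
            Real.sqrt (Carleman.gradSq (uncurry (vorticity U)) (A z)))) :=
          mul_le_mul_of_nonneg_left h hc₀.le
      _ = (2 * K) * (c₀ * ‖(uncurry (vorticity U)) (A z)‖ +
            c₀ * Real.sqrt (Carleman.gradSq (uncurry (vorticity U)) (A z))) := by ring
  -- ### (hbound), (h0)
  have hbound : ∀ z ∈ Q, ‖u z‖ ≤ 1 := by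
    intro z hz
    rw [huQ z hz, hnormut]
    calc c₀ * ‖(uncurry (vorticity U)) (A z)‖
        ≤ c₀ * (‖curlCLM‖ * K) := mul_le_mul_of_nonneg_left (hbounds _ (hAO z hz)).1 hc₀.le
      _ ≤ 1 := hc₀1
  have h0 : ∀ y : E³, κ * ‖y‖ < ⟪y, e⟫ → u (0, y) = 0 := fun y _ => if_neg (lt_irrefl 0)
  -- ### (hH3) square integrability of `∂ₜu` on bounded sets
  have hH3 : ∀ K' ⊆ Q, Bornology.IsBounded K' → MeasurableSet K' →
      ∫⁻ z in K', ‖Carleman.dt u z‖ₑ ^ 2 < ∞ := by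
    intro K' hK' hK'b hK'm
    have hbd : ∀ z ∈ K', ‖Carleman.dt u z‖ₑ ^ 2 ≤
        ENNReal.ofReal ((c₀ * (3 * 1 * ‖curlCLM‖ * K + 2 * ‖curlCLM‖ * K ^ 2)) ^ 2) := by
      intro z hz
      have hzQ := hK' hz
      rw [(hframe z hzQ).1, hdtut]
      have hn : ‖c₀ • ((-1 : ℝ) • Carleman.dt (uncurry (vorticity U)) (A z))‖ ≤
          c₀ * (3 * 1 * ‖curlCLM‖ * K + 2 * ‖curlCLM‖ * K ^ 2) := by
        rw [norm_smul, norm_smul, Real.norm_eq_abs, abs_of_pos hc₀, Real.norm_eq_abs, abs_neg,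
          abs_one, one_mul]
        exact mul_le_mul_of_nonneg_left (hbounds _ (hAO z hzQ)).2 hc₀.le
      calc ‖c₀ • ((-1 : ℝ) • Carleman.dt (uncurry (vorticity U)) (A z))‖ₑ ^ 2
          = ENNReal.ofReal (‖c₀ • ((-1 : ℝ) • Carleman.dt (uncurry (vorticity U)) (A z))‖ ^ 2) := by
            rw [← ofReal_norm, ENNReal.ofReal_pow (norm_nonneg _)]
        _ ≤ ENNReal.ofReal ((c₀ * (3 * 1 * ‖curlCLM‖ * K + 2 * ‖curlCLM‖ * K ^ 2)) ^ 2) :=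
            ENNReal.ofReal_le_ofReal (pow_le_pow_left₀ (norm_nonneg _) hn 2)
    calc ∫⁻ z in K', ‖Carleman.dt u z‖ₑ ^ 2
        ≤ ∫⁻ _ in K', ENNReal.ofReal ((c₀ * (3 * 1 * ‖curlCLM‖ * K + 2 * ‖curlCLM‖ * K ^ 2)) ^ 2) :=
          setLIntegral_mono' hK'm hbd
      _ = ENNReal.ofReal ((c₀ * (3 * 1 * ‖curlCLM‖ * K + 2 * ‖curlCLM‖ * K ^ 2)) ^ 2) * volume K' :=
          setLIntegral_const _ _
      _ < ∞ := ENNReal.mul_lt_top ENNReal.ofReal_lt_top hK'b.measure_lt_top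
  -- ### (hcont) continuity up to the initial plane
  have hutcQ : ∀ z ∈ Q, ContinuousAt ut z := by
    intro z hz
    have h1 : ContinuousAt (uncurry (vorticity U)) (A z) :=
      hω1.continuousOn.continuousAt (hOo.mem_nhds (hAO z hz))
    have h2 : ContinuousAt A z := (continuous_stAffine (-1 : ℝ) 1 0 x₀).continuousAt
    exact (h1.comp_of_eq h2 rfl).const_smul c₀
  have hcont : ContinuousOn u (Ico (0 : ℝ) 1 ×ˢ H) := by
    rintro ⟨s', y⟩ ⟨hs', hy⟩
    rcases (hs'.1).eq_or_lt with h0s | hspos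
    · -- the bottom `s' = 0`
      subst h0s
      rw [Metric.continuousWithinAt_iff]
      intro ε hε
      set θ : ℝ := ε / (2 * (c₀ * ‖curlCLM‖ + 1)) with hθdef
      have hθ : 0 < θ := by positivity
      have hθε : c₀ * ‖curlCLM‖ * θ < ε := by
        have h1 : c₀ * ‖curlCLM‖ * θ ≤ (c₀ * ‖curlCLM‖ + 1) * θ := by nlinarith
        have h2 : (c₀ * ‖curlCLM‖ + 1) * θ = ε / 2 := by rw [hθdef]; field_simp
        linarith
      obtain ⟨s₀, δ₁, hs₀, -, hδ₁, hsm⟩ := hsmall (x₀ + y) (hx₀S y hy) θ hθ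
      refine ⟨min (-s₀) δ₁, lt_min (by linarith) hδ₁, ?_⟩
      rintro ⟨s'', y'⟩ ⟨hs'', hy'⟩ hdist
      rw [Prod.dist_eq, max_lt_iff] at hdist
      obtain ⟨hd1, hd2⟩ := hdist
      rw [Real.dist_eq, sub_zero] at hd1
      have hu0 : u (0, y) = 0 := if_neg (lt_irrefl 0)
      rw [hu0, dist_zero_right]
      rcases (hs''.1).eq_or_lt with h0 | hpos
      · have hs0 : s'' = 0 := by simpa using h0.symm
        have : u (s'', y') = 0 := by
          show (if (0 : ℝ) < s'' then ut (s'', y') else 0) = 0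
          rw [hs0, if_neg (lt_irrefl 0)]
        rw [this, norm_zero]; exact hε
      · have hzQ : ((s'', y') : ℝ × E³) ∈ Q := ⟨⟨hpos, hs''.2⟩, hy'⟩
        rw [huQ _ hzQ, hnormut, hA]
        have hs''abs : |s''| = s'' := abs_of_pos hpos
        have hneg : -s'' ∈ Ioo s₀ 0 := ⟨by
            have : s'' < -s₀ := by rw [← hs''abs]; exact hd1.trans_le (min_le_left _ _)
            linarith, by linarith⟩
        have hball : x₀ + y' ∈ ball (x₀ + y) δ₁ := by
          rw [mem_ball, dist_eq_norm, add_sub_add_left_eq_sub, ← dist_eq_norm]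
          exact hd2.trans_le (min_le_right _ _)
        obtain ⟨-, hD⟩ := hsm (-s'') hneg (x₀ + y') hball
        have hω : ‖(uncurry (vorticity U)) (-s'', x₀ + y')‖ ≤ ‖curlCLM‖ * θ := by
          show ‖vorticity U (-s'') (x₀ + y')‖ ≤ ‖curlCLM‖ * θ
          rw [vorticity_apply]
          exact (norm_curl_le _ _).trans (mul_le_mul_of_nonneg_left hD hκ0)
        calc c₀ * ‖(uncurry (vorticity U)) (-s'', x₀ + y')‖
            ≤ c₀ * (‖curlCLM‖ * θ) := mul_le_mul_of_nonneg_left hω hc₀.le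
          _ = c₀ * ‖curlCLM‖ * θ := by ring
          _ < ε := hθε
    · -- interior points `s' > 0`
      have hzQ : ((s', y) : ℝ × E³) ∈ Q := ⟨⟨hspos, hs'.2⟩, hy⟩
      have hev : u =ᶠ[𝓝 ((s', y) : ℝ × E³)] ut := by
        filter_upwards [(isOpen_lt continuous_const continuous_fst).mem_nhds
          (show (0 : ℝ) < ((s', y) : ℝ × E³).1 from hspos)] with z hz
        exact if_pos hz
      exact ((hutcQ _ hzQ).congr_of_eventuallyEq hev).continuousWithinAt
  -- ### backward uniqueness in the cone (the hypothesis `hBU`)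
  have hzero : ∀ z ∈ Q, u z = 0 := hBU u (2 * K) (by positivity) hu1 hux hcont h0 hBH hbound hH3
  -- ### conclusion at the target point `(t, x)`
  set z : ℝ × E³ := (-t, x - x₀) with hzdef
  have hzQ : z ∈ Q := ⟨⟨by linarith [ht.2], by linarith [ht.1]⟩, hx⟩
  have h := hzero z hzQ
  rw [huQ z hzQ, hutdef] at h
  have h' : (uncurry (vorticity U)) (A z) = 0 := by
    rcases smul_eq_zero.1 h with h1 | h1
    · exact absurd h1 hc₀.ne'
    · exact h1
  have hAz : A z = (t, x) := by
    rw [hA]; simp [hzdef]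
  rw [hAz] at h'
  simpa [vorticity_apply] using h'

end Summit.NavierStokesRegularity.NavierStokesRegularity.Theorems.RellichScarApexLocalisation

end
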